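/-
Origin: expansion seat `planner-pub-hodgecm-pv08-g5-0`, handover #3 2026-08-18T07:13:03Z (`HOME/pub-hodgecm-pv08-g5/lean/Pv08g5/SeesawSchwartzModel.lean`, md5 84ec8172, 322 lines);
landed by the gen-7 packager in gate run 25 as `HodgeCM/Model/Toy/SeesawSchwartzModel.lean` (verbatim).
-/
/-
Origin: HOME/pub-hodgecm-pv08-g5/lean/Pv08g5/SeesawSchwartzModel.lean — session planner-pub-hodgecm-pv08-g5-0 (unit pub-hodgecm-pv08-g5,
DAG-NODE PROVER #08 gen 5).  TOY / WITNESS file for the N17 lattice-sum shell `HodgeCM.PerL34.Seesaw.ThetaSeesawData` (pv11, r20) that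
carries BOTH halves of seam S5 (`SeesawDictionary.SeesawBridge`, r22; `QautSeesaw.QautSeesawBridge`, pv08-g5 F3, run 25).  Intended final
place: `HodgeCM/Model/Toy/SeesawSchwartzModel.lean` (input of NOTHING).  Imports LANDED modules + Mathlib only.  Asserts nothing.
-/
import Summits.HodgeConjecture.HodgeCM.PerL34.SeesawWedge
import Summits.HodgeConjecture.HodgeCM.PerL34.LatticeTheta
import Mathlib.LinearAlgebra.TensorProduct.Basic
import Mathlib.Analysis.Fourier.AddCircle
import Mathlib.Algebra.Module.ZLattice.Basic

/-!
# A two-sided Schwartz–lattice model of the seesaw shell in which ALL SIX N17 hypotheses are THEOREMS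

The shell `ThetaSeesawData` of `Seesaw.lean` (node N17 = PerL v5 Lemma 3.4) posits the data
`(G, [U(W₁)], [U(W₂)], X₁, X₂, 𝒮₁, 𝒮₂, 𝒮, ev, ⊗, ω₁, ω₂, ω_W)` and the S5 records (`SeesawBridge` for (12), `QautSeesawBridge` for (34))
carry as HYPOTHESIS FIELDS exactly six sentences about it: `OmegaSub`, `EvSub` (subtractivity of the Weil action on `𝒮` and of evaluation),
`EvalTmul` ((φ₁⊗φ₂)(x₁,x₂) = φ₁(x₁)φ₂(x₂)), `RestrictTmul` (ω_W|(u₁,u₂) (φ₁⊗φ₂) = ω₁(u₁)φ₁ ⊗ ω₂(u₂)φ₂ — PRINT-DERIVED, HKS/Ku94),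
`AbsSummable₁/₂` (absolute convergence of the theta series — PRINT, Weil 1964 nos 17–18).  The only inhabitants of the shell in the tree
are DEGENERATE (`S5Conservative.shell`: everything `Unit`/junk; `Model/Toy/SupplyCircleModel`: `𝒮 :=` ALL functions on `ℚ`, for which
`AbsSummable` FAILS, so it witnesses route (E) but not the S5 hypothesis set).

This file gives the smallest HONEST model of the intended shape in which all six hold, from Mathlib alone:

* `G := ℝ` acting on `𝒮_j := 𝓢(ℝ, ℂ)` (Mathlib's Schwartz space) by TRANSLATION (`SchwartzMap.compSubConstCLM`), the compact tori
  `[U(W_j)] := U(1) = ℝ/ℤ` (Mathlib's `UnitAddCircle`, with its Haar probability measure `haarAddCircle` and characters `fourier m`,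
  `m ∈ ℤ`) acting through the weight-`k_j` character, so `ω_j(g,u) φ = e(k_j u) · φ(· − g)` — a genuine, non-trivial, `ℂ`-linear action;
* rational points `X_j := ℤ ⊂ ℝ` (the `ℤ`-span of `1`, a discrete full lattice), `ev_j φ v := φ(v)`;
* `𝒮 := 𝓢(ℝ,ℂ) ⊗_ℂ 𝓢(ℝ,ℂ)` (algebraic tensor product), `φ₁ ⊗ φ₂ := φ₁ ⊗ₜ φ₂`, `ev Φ (m,n)` := the linear extension of `φ₁(m)φ₂(n)`,
  `ω_W(g,(u₁,u₂)) := ω₁(g,u₁) ⊗ ω₂(g,u₂)` (`TensorProduct.map`).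

THEN (all kernel): `OmegaSub`, `EvSub` are linearity; `EvalTmul` is `TensorProduct.lift.tmul`; `RestrictTmul` is `TensorProduct.map_tmul`;
`AbsSummable_j` is pv11-g2's Mathlib-only `LatticeTheta.summable_norm_restrict` (Schwartz decay summed over a discrete lattice); and BY
DEFINITION of `thetaKernel_j` the theta kernel of the model IS the lattice sum `θ_φ(g,u) = e(k u) · Σ_{n ∈ ℤ} φ(n − g)` (`thetaKernel₁_eq`) —
continuous in `g` (`LatticeTheta.continuous_tsum_translate`), `ℤ`-periodic in `g`, of weight `k` in `u`; pv11's landed N17 theorem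
`ThetaSeesawData.thetaKernel_tmul` yields, NON-VACUOUSLY, (eq:seesaw) for kernels in this model:
`θ_{φ₁⊗φ₂}(g,(u₁,u₂)) = θ_{φ₁}(g,u₁) · θ_{φ₂}(g,u₂)` (`seesaw_kernel`), i.e. `(e(k₁u₁) Σ_m φ₁(m−g)) (e(k₂u₂) Σ_n φ₂(n−g))`; and (§5) the
TORUS PERIODS are computed: against the character of weight `m` (pv11's `thetaLift_j ν χ'`, `χ' = conj e(m ·) = fourier (−m)`, `ν =` Haar)
`θ(φ, χ'_m)(g) = [m = k] · Σ_{n∈ℤ} φ(n − g)` (`thetaLift₁_eq`, from Mathlib's `fourierCoeff_fourier` = orthogonality of characters) — the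
toy form of PerL's WEIGHT SELECTION "θ(φ_j, χ'_j) vanishes unless the `U(1)`-type of φ_j matches χ'_j" (ll. 362–364 / L4.1(a); in the
package: `ArchA.N27_converse`) — and pv11's integrated (eq:seesaw) `ThetaSeesawData.eq_seesaw` gives the period of a pure tensor
`ϑ_{T,χ'_{m₁}⊠χ'_{m₂}}(φ₁⊗φ₂)(g) = [m₁ = k₁][m₂ = k₂] · (Σ φ₁(n−g)) (Σ φ₂(n−g))` (`thetaPeriod_tmul_eq`), zero off the weight pair.

What this shows, exactly: the six-sentence hypothesis SET of the S5 shell is jointly satisfiable in a model with infinite lattices on both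
sides, a genuine tensor product and a non-trivial Weil-type action, and its sentences are of the kind that hold by unfolding definitions /
linearity in such a model.  What it does NOT show: anything about the adelic Weil representation `ω_{W,μ_W}` of PerL §3 (D4 proper), whose
construction is out of the cell's scope (GAPS carverg2-X1).  No statement of the 2001 programme, of PerL or of QW8 is used or cited.

Unit `pub-hodgecm-pv08-g5`, 2026-08-18.  Fully kernel-checked; standard axiom trio.
-/

set_option autoImplicit false

noncomputable section

open scoped SchwartzMap TensorProduct
open HodgeCM.PerL34.Seesaw HodgeCM.PerL34.LatticeTheta

namespace HodgeCM
namespace PerL34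
namespace Seesaw
namespace SchwartzModel

/-! ## §1. The carriers -/

/-- the Schwartz space `𝓢(ℝ, ℂ)` (both `𝒮₁` and `𝒮₂` of the model). -/
abbrev Sch : Type := 𝓢(ℝ, ℂ)

/-- the lattice of rational points: `ℤ = ℤ·1 ⊂ ℝ` as a `ℤ`-submodule (discrete, full: Mathlib instances for the span of a basis). -/
abbrev LZ : Submodule ℤ ℝ := Submodule.span ℤ (Set.range (Module.Basis.singleton Unit ℝ))

/-- (Ported verbatim from the HodgeCMPerL package; no docstring in the source.) -/
theorem one_mem_LZ : (1 : ℝ) ∈ LZ :=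
  Submodule.subset_span ⟨(), by simp⟩

/-- (Ported verbatim from the HodgeCMPerL package; no docstring in the source.) -/
theorem intCast_mem_LZ (n : ℤ) : (n : ℝ) ∈ LZ := by
  simpa using LZ.smul_mem n one_mem_LZ

/-- the compact torus `[U(W_j)] = U(1)`, as `ℝ/ℤ` (Mathlib `UnitAddCircle = AddCircle 1`; characters `fourier m u = e(m u)`). -/
abbrev 𝕋 : Type := UnitAddCircle

/-- the Weil-type action of `(g, u) ∈ G × [U(W_j)] = ℝ × U(1)` on `𝓢(ℝ, ℂ)`: translate by `g`, multiply by the weight-`k` character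
`e(k u)`. -/
def act (k : ℤ) (g : ℝ) (u : 𝕋) : Sch →ₗ[ℂ] Sch :=
  (fourier k u : ℂ) • (SchwartzMap.compSubConstCLM ℂ g : Sch →L[ℂ] Sch).toLinearMap

/-- (Ported verbatim from the HodgeCMPerL package; no docstring in the source.) -/
@[simp] theorem act_apply (k : ℤ) (g : ℝ) (u : 𝕋) (φ : Sch) (x : ℝ) :
    act k g u φ x = fourier k u * φ (x - g) := by
  simp [act]

/-- evaluation of `𝒮 = 𝓢 ⊗ 𝓢` at a pair of points: the linear extension of `φ₁(m) φ₂(n)`. -/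
def evBil (m n : ℝ) : Sch →ₗ[ℂ] Sch →ₗ[ℂ] ℂ :=
  LinearMap.mk₂ ℂ (fun φ₁ φ₂ => φ₁ m * φ₂ n) (fun _ _ _ => by simp [add_mul]) (fun _ _ _ => by simp [mul_assoc])
    (fun _ _ _ => by simp [mul_add]) (fun _ _ _ => by simp [mul_left_comm])

/-- (Ported verbatim from the HodgeCMPerL package; no docstring in the source.) -/
@[simp] theorem lift_evBil_tmul (m n : ℝ) (φ₁ φ₂ : Sch) :
    TensorProduct.lift (evBil m n) (φ₁ ⊗ₜ φ₂) = φ₁ m * φ₂ n := by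
  simp [evBil]

/-! ## §2. The model and its six N17 hypotheses -/

/-- **The two-sided Schwartz–lattice model** of the seesaw shell, weights `k₁, k₂ ∈ ℤ`. -/
@[reducible] def model (k₁ k₂ : ℤ) : ThetaSeesawData where
  G := ℝ
  A₁ := 𝕋
  A₂ := 𝕋
  X₁ := LZ
  X₂ := LZ
  S₁ := Sch
  S₂ := Sch
  S := Sch ⊗[ℂ] Sch
  ev₁ φ v := φ (v : ℝ)
  ev₂ φ v := φ (v : ℝ)
  ev Φ z := TensorProduct.lift (evBil (z.1 : ℝ) (z.2 : ℝ)) Φ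
  tmul φ₁ φ₂ := φ₁ ⊗ₜ φ₂
  ω₁ g u φ := act k₁ g u φ
  ω₂ g u φ := act k₂ g u φ
  ωW g t Φ := TensorProduct.map (act k₁ g t.1) (act k₂ g t.2) Φ

variable (k₁ k₂ : ℤ)

/-- (Ported verbatim from the HodgeCMPerL package; no docstring in the source.) -/
instance : AddCommGroup (model k₁ k₂).S := inferInstanceAs (AddCommGroup (Sch ⊗[ℂ] Sch))

/-- N17 hypothesis 1: the Weil action on `𝒮` is subtractive (it is linear). -/
theorem omegaSub : (model k₁ k₂).OmegaSub := fun _ _ Φ Φ' => map_sub _ Φ Φ'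

/-- N17 hypothesis 2: evaluation on `𝒮` is subtractive (it is linear). -/
theorem evSub : (model k₁ k₂).EvSub := fun Φ Φ' _ => map_sub _ Φ Φ'

/-- N17 hypothesis 3: `(φ₁ ⊗ φ₂)(x₁, x₂) = φ₁(x₁) φ₂(x₂)`. -/
theorem evalTmul : (model k₁ k₂).EvalTmul := fun φ₁ φ₂ _ => lift_evBil_tmul _ _ φ₁ φ₂

/-- N17 hypothesis 4 (the PRINT-DERIVED one in the S5 records): `ω_W|(u₁,u₂) (φ₁ ⊗ φ₂) = ω₁(u₁)φ₁ ⊗ ω₂(u₂)φ₂`. -/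
theorem restrictTmul : (model k₁ k₂).RestrictTmul := fun g u₁ u₂ φ₁ φ₂ =>
  TensorProduct.map_tmul (act k₁ g u₁) (act k₂ g u₂) φ₁ φ₂

/-- N17 hypothesis 5 (PRINT in the records: absolute convergence of the theta series), here Schwartz decay over a lattice. -/
theorem absSummable₁ : (model k₁ k₂).AbsSummable₁ := fun ψ => summable_norm_restrict LZ ψ

/-- N17 hypothesis 6. -/
theorem absSummable₂ : (model k₁ k₂).AbsSummable₂ := fun ψ => summable_norm_restrict LZ ψ

/-! ## §3. The theta kernels of the model ARE lattice sums; (eq:seesaw) non-vacuously -/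

/-- `θ_φ(g, u) = e(k₁u) · Σ_{n ∈ ℤ} φ(n − g)`, by unfolding `ThetaSeesawData.thetaKernel₁`. -/
theorem thetaKernel₁_eq (φ : Sch) (g : ℝ) (u : 𝕋) :
    (model k₁ k₂).thetaKernel₁ φ g u = fourier k₁ u * ∑' v : LZ, φ ((v : ℝ) - g) := by
  show (∑' v : LZ, act k₁ g u φ (v : ℝ)) = _
  simp only [act_apply]
  exact tsum_mul_left

/-- (Ported verbatim from the HodgeCMPerL package; no docstring in the source.) -/
theorem thetaKernel₂_eq (φ : Sch) (g : ℝ) (u : 𝕋) :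
    (model k₁ k₂).thetaKernel₂ φ g u = fourier k₂ u * ∑' v : LZ, φ ((v : ℝ) - g) := by
  show (∑' v : LZ, act k₂ g u φ (v : ℝ)) = _
  simp only [act_apply]
  exact tsum_mul_left

/-- the lattice sum is a CONTINUOUS function of `g ∈ G` (pv11-g2's `LatticeTheta.continuous_tsum_translate`). -/
theorem continuous_thetaKernel₁ (φ : Sch) (u : 𝕋) :
    Continuous fun g : ℝ => (model k₁ k₂).thetaKernel₁ φ g u := by
  simp only [thetaKernel₁_eq]
  refine continuous_const.mul ?_
  have h := (continuous_tsum_translate LZ φ).comp continuous_neg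
  refine h.congr fun g => ?_
  simp only [Function.comp_apply]
  exact tsum_congr fun v => by rw [neg_add_eq_sub]

/-- … `ℤ`-PERIODIC in `g` (the theta function lives on `G(L₀)\G(𝔸)`-type quotients: here `ℤ\ℝ`). -/
theorem thetaKernel₁_periodic (φ : Sch) (g : ℝ) (u : 𝕋) (w : LZ) :
    (model k₁ k₂).thetaKernel₁ φ (g + (w : ℝ)) u = (model k₁ k₂).thetaKernel₁ φ g u := by
  simp only [thetaKernel₁_eq]
  congr 1
  have h := tsum_translate_add_mem LZ φ (-g) (-w)
  simp only [Submodule.coe_neg] at h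
  refine (tsum_congr fun v => ?_).trans (h.trans (tsum_congr fun v => ?_))
  · congr 1; ring
  · congr 1; ring

/-- … and of WEIGHT `k₁` under the torus: `θ_φ(g, u + t) = e(k₁t) θ_φ(g, u)`. -/
theorem thetaKernel₁_weight (φ : Sch) (g : ℝ) (u t : 𝕋) :
    (model k₁ k₂).thetaKernel₁ φ g (u + t) = fourier k₁ t * (model k₁ k₂).thetaKernel₁ φ g u := by
  rw [thetaKernel₁_eq, thetaKernel₁_eq, fourier_apply, fourier_apply, fourier_apply, smul_add, AddCircle.toCircle_add,
    Circle.coe_mul]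
  ring

/-- a smooth bump (Mathlib's `ContDiffBump`): radius data `rIn = 1/2 < rOut = 1` around `0`. -/
def B : ContDiffBump (0 : ℝ) := ⟨2⁻¹, 1, by norm_num, by norm_num⟩

/-- a concrete Schwartz function: the bump, `= 1` on `[-1/2, 1/2]`, `= 0` outside `(-1, 1)`. -/
def bump : Sch :=
  (B.hasCompactSupport.comp_left (g := fun r : ℝ => (r : ℂ)) Complex.ofReal_zero).toSchwartzMap
    (Complex.ofRealCLM.contDiff.comp B.contDiff)

/-- (Ported verbatim from the HodgeCMPerL package; no docstring in the source.) -/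
theorem bump_apply (x : ℝ) : bump x = (B x : ℂ) := rfl

/-- (Ported verbatim from the HodgeCMPerL package; no docstring in the source.) -/
theorem bump_zero : bump 0 = 1 := by
  rw [bump_apply, B.one_of_mem_closedBall] <;> simp [B]

/-- (Ported verbatim from the HodgeCMPerL package; no docstring in the source.) -/
theorem bump_neg_one : bump (-1) = 0 := by
  rw [bump_apply, B.zero_of_le_dist] <;> simp [B]

/-- the action is NON-TRIVIAL: translation by `1 ∈ G` moves the bump (so the model is not degenerate in `G`). -/
theorem act_bump_ne : act k₁ 1 0 bump ≠ bump := by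
  intro h
  have h0 := congrArg (fun ψ : Sch => ψ 0) h
  simp only [act_apply, fourier_eval_zero, one_mul, zero_sub, bump_neg_one, bump_zero] at h0
  exact zero_ne_one h0

/-- (Ported verbatim from the HodgeCMPerL package; no docstring in the source.) -/
theorem mem_LZ_iff (x : ℝ) : x ∈ LZ ↔ ∃ n : ℤ, (n : ℝ) = x := by
  have hr : Set.range (⇑(Module.Basis.singleton Unit ℝ)) = {1} := by
    ext y
    simp
  rw [show LZ = Submodule.span ℤ (Set.range (⇑(Module.Basis.singleton Unit ℝ))) from rfl, hr,
    Submodule.mem_span_singleton]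
  simp

/-- the lattice sum of the bump is `Σ_{n∈ℤ} bump(n) = bump(0) = 1` (the only lattice point in the support `(-1, 1)` is `0`). -/
theorem tsum_bump : ∑' v : LZ, bump (v : ℝ) = 1 := by
  rw [tsum_eq_single (0 : LZ)]
  · simp [bump_zero]
  · intro v hv
    have hv' : (v : ℝ) ≠ 0 := fun h => hv (Subtype.ext h)
    obtain ⟨n, hn⟩ := (mem_LZ_iff (v : ℝ)).1 v.2
    have hn0 : n ≠ 0 := by rintro rfl; exact hv' (by simpa using hn.symm)
    have h1 : (1 : ℝ) ≤ |(v : ℝ)| := by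
      rw [← hn, ← Int.cast_abs]
      exact_mod_cast Int.one_le_abs hn0
    rw [bump_apply, B.zero_of_le_dist, Complex.ofReal_zero]
    simpa [B, Real.dist_eq] using h1

/-- … so the theta kernel of the bump is NOT identically zero: `θ_bump(0, 0) = 1`. -/
theorem thetaKernel₁_bump : (model k₁ k₂).thetaKernel₁ bump 0 0 = 1 := by
  rw [thetaKernel₁_eq]
  simp only [fourier_eval_zero, one_mul, sub_zero]
  exact tsum_bump

/-! ## §4. (eq:seesaw) for kernels, non-vacuously, from pv11's landed N17 theorem -/

/-- pv11's `ThetaSeesawData.thetaKernel_tmul` (kernel form of PerL (eq:seesaw), proved in `Seesaw.lean` from the six hypotheses) applied to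
the model, where all six are theorems: `θ_{φ₁⊗φ₂}(g,(u₁,u₂)) = θ_{φ₁}(g,u₁) θ_{φ₂}(g,u₂)`. -/
theorem seesaw_kernel (φ₁ φ₂ : Sch) (g : ℝ) (u₁ u₂ : 𝕋) :
    (model k₁ k₂).thetaKernel (φ₁ ⊗ₜ φ₂) g (u₁, u₂)
      = (model k₁ k₂).thetaKernel₁ φ₁ g u₁ * (model k₁ k₂).thetaKernel₂ φ₂ g u₂ :=
  (model k₁ k₂).thetaKernel_tmul (evalTmul k₁ k₂) (restrictTmul k₁ k₂) (absSummable₁ k₁ k₂) (absSummable₂ k₁ k₂)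
    φ₁ φ₂ g (u₁, u₂)

/-- the same, with both sides written out as lattice sums. -/
theorem seesaw_kernel_explicit (φ₁ φ₂ : Sch) (g : ℝ) (u₁ u₂ : 𝕋) :
    (model k₁ k₂).thetaKernel (φ₁ ⊗ₜ φ₂) g (u₁, u₂)
      = (fourier k₁ u₁ * ∑' v : LZ, φ₁ ((v : ℝ) - g)) * (fourier k₂ u₂ * ∑' v : LZ, φ₂ ((v : ℝ) - g)) := by
  rw [seesaw_kernel, thetaKernel₁_eq, thetaKernel₂_eq]

/-- in particular the product kernel is not identically zero either (bump ⊗ bump at `g = 0`, `u = (0,0)`). -/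
theorem thetaKernel_bump_tmul_bump : (model k₁ k₂).thetaKernel (bump ⊗ₜ bump) 0 (0, 0) = 1 := by
  rw [seesaw_kernel_explicit]
  simp only [fourier_eval_zero, one_mul, sub_zero]
  rw [tsum_bump, one_mul]

/-! ## §5. Torus periods: weight selection, and the integrated (eq:seesaw) non-vacuously -/

open MeasureTheory

/-- **Weight selection.** The torus period of the theta kernel against the character of weight `m` (pv11's `thetaLift₁ ν χ'` with
`ν =` Haar probability on `U(1)` and `χ' = fourier (−m) = conj e(m·)`) is the lattice sum if `m = k₁` and ZERO otherwise — Mathlib's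
orthogonality of characters `fourierCoeff_fourier`.  Toy form of "θ(φ_j, χ'_j) vanishes unless the type of φ_j matches χ'_j". -/
theorem thetaLift₁_eq (m : ℤ) (φ : Sch) (g : ℝ) :
    (model k₁ k₂).thetaLift₁ AddCircle.haarAddCircle (fourier (-m)) φ g = if m = k₁ then ∑' v : LZ, φ ((v : ℝ) - g) else 0 := by
  have h := congrFun (fourierCoeff_fourier (T := 1) k₁) m
  simp only [fourierCoeff, smul_eq_mul, Pi.single_apply] at h
  show (∫ u, (model k₁ k₂).thetaKernel₁ φ g u * fourier (-m) u ∂AddCircle.haarAddCircle) = _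
  simp only [thetaKernel₁_eq]
  calc (∫ u : 𝕋, fourier k₁ u * (∑' v : LZ, φ ((v : ℝ) - g)) * fourier (-m) u ∂AddCircle.haarAddCircle)
      = (∑' v : LZ, φ ((v : ℝ) - g)) * ∫ u : 𝕋, fourier (-m) u * fourier k₁ u ∂AddCircle.haarAddCircle := by
        rw [← integral_const_mul]
        exact integral_congr_ae (Filter.Eventually.of_forall fun u => by simp only; ring)
    _ = if m = k₁ then ∑' v : LZ, φ ((v : ℝ) - g) else 0 := by
        rw [h]
        split_ifs <;> simp

/-- (Ported verbatim from the HodgeCMPerL package; no docstring in the source.) -/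
theorem thetaLift₂_eq (m : ℤ) (φ : Sch) (g : ℝ) :
    (model k₁ k₂).thetaLift₂ AddCircle.haarAddCircle (fourier (-m)) φ g = if m = k₂ then ∑' v : LZ, φ ((v : ℝ) - g) else 0 := by
  have h := congrFun (fourierCoeff_fourier (T := 1) k₂) m
  simp only [fourierCoeff, smul_eq_mul, Pi.single_apply] at h
  show (∫ u, (model k₁ k₂).thetaKernel₂ φ g u * fourier (-m) u ∂AddCircle.haarAddCircle) = _
  simp only [thetaKernel₂_eq]
  calc (∫ u : 𝕋, fourier k₂ u * (∑' v : LZ, φ ((v : ℝ) - g)) * fourier (-m) u ∂AddCircle.haarAddCircle)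
      = (∑' v : LZ, φ ((v : ℝ) - g)) * ∫ u : 𝕋, fourier (-m) u * fourier k₂ u ∂AddCircle.haarAddCircle := by
        rw [← integral_const_mul]
        exact integral_congr_ae (Filter.Eventually.of_forall fun u => by simp only; ring)
    _ = if m = k₂ then ∑' v : LZ, φ ((v : ℝ) - g) else 0 := by
        rw [h]
        split_ifs <;> simp

/-- **(eq:seesaw), integrated form, non-vacuously** (pv11's landed `ThetaSeesawData.eq_seesaw`, Fubini, with its four hypotheses now
theorems): the period of the pure tensor against `χ'_{m₁} ⊠ χ'_{m₂}` over `[T] = U(1) × U(1)` is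
`[m₁ = k₁][m₂ = k₂] · (Σ φ₁(n−g)) (Σ φ₂(n−g))`. -/
theorem thetaPeriod_tmul_eq (m₁ m₂ : ℤ) (φ₁ φ₂ : Sch) (g : ℝ) :
    (model k₁ k₂).thetaPeriod AddCircle.haarAddCircle AddCircle.haarAddCircle (fourier (-m₁)) (fourier (-m₂)) (φ₁ ⊗ₜ φ₂) g
      = (if m₁ = k₁ then ∑' v : LZ, φ₁ ((v : ℝ) - g) else 0) * (if m₂ = k₂ then ∑' v : LZ, φ₂ ((v : ℝ) - g) else 0) := by
  rw [← thetaLift₁_eq k₁ k₂, ← thetaLift₂_eq k₁ k₂]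
  exact ((model k₁ k₂).eq_seesaw AddCircle.haarAddCircle AddCircle.haarAddCircle (evalTmul k₁ k₂) (restrictTmul k₁ k₂) (absSummable₁ k₁ k₂)
    (absSummable₂ k₁ k₂) (fourier (-m₁)) (fourier (-m₂)) φ₁ φ₂ g).symm

/-- … in particular it VANISHES off the weight pair `(k₁, k₂)`. -/
theorem thetaPeriod_tmul_eq_zero (m₁ m₂ : ℤ) (h : m₁ ≠ k₁ ∨ m₂ ≠ k₂) (φ₁ φ₂ : Sch) (g : ℝ) :
    (model k₁ k₂).thetaPeriod AddCircle.haarAddCircle AddCircle.haarAddCircle (fourier (-m₁)) (fourier (-m₂)) (φ₁ ⊗ₜ φ₂) g = 0 := by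
  rw [thetaPeriod_tmul_eq]
  rcases h with h | h <;> simp [h]

/-- … and is NON-ZERO on it: `ϑ(bump ⊗ bump)(χ'_{k₁} ⊠ χ'_{k₂})(0) = 1`. -/
theorem thetaPeriod_bump_tmul_bump :
    (model k₁ k₂).thetaPeriod AddCircle.haarAddCircle AddCircle.haarAddCircle (fourier (-k₁)) (fourier (-k₂)) (bump ⊗ₜ bump) 0 = 1 := by
  rw [thetaPeriod_tmul_eq]
  simp only [if_true, sub_zero]
  rw [tsum_bump, one_mul]

end SchwartzModel
end Seesaw
end PerL34
end HodgeCM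

end
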